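import Mathlib
import HarnessLib
import Literature.NumberTheory.LFunctions.ZetaScrew
import Summits.RiemannHypothesis.RiemannHypothesis.Theorems.IntegerScrewDefs
import Summits.RiemannHypothesis.RiemannHypothesis.Theorems.IntegerScrewNestedSylvester
import Summits.RiemannHypothesis.RiemannHypothesis.Theorems.IntegerScrewPivotCriterion

/-!
# Route `IntegerScrew` — the pivot as a MINIMUM and its innovation upper bound `d_M ≤ 2Ψ(log(M/(M−1)))`

The DERIVED layer of the «pivot law» of the A6-PIVOT track (HOME/pivot/PIVOT-LAW.md §1/§2a):
`M·d_M = L(M) − G(M)` with `L(M) := M·2Ψ(log(M/(M−1)))` and `G(M) ≥ 0`. Here `d_M = screwPivot M`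
(`Theorems/IntegerScrewDefs.lean`) is the `M`-th LDLᵀ pivot of the nested screw Gram matrices
`S_M = screwMatrix (M − 1)` of Suzuki's kernel `G(t,u) = Ψ(t) + Ψ(u) − Ψ(t − u)`.

* `neg_dotProduct_inv_mulVec_le` — completing the square: for a real `A ≻ 0`,
  `−bᵀA⁻¹b ≤ yᵀAy + 2bᵀy` for every `y` (pure linear algebra).
* `screwPivot_add_two_eq_schur` — with `S_{n+1} ≻ 0`, `d_{n+2} = 2Ψ(log(n+2)) − bᵀ S_{n+1}⁻¹ b`
  (`b = screwBorder n`), i.e. the pivot IS the scalar Schur complement;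
  `screwPivot_add_two_eq_form_filter` — it is the value of the quadratic form of `S_{n+2}` at
  `(−φ, 1)` with `φ := S_{n+1}⁻¹ b` (the optimal one-step predictor of the census / SOS-THEORY §9);
  `screwPivot_add_two_le_form` — and it is BELOW the value at every other `(y, 1)`:
  `d_{n+2} = min_y Q_{S_{n+2}}(y, 1)` (squared distance of the newest point of Kreĭn's screw line from
  the span of the earlier ones).
* Trial vectors: `y = 0` gives `screwPivot_le_two_zetaScrew_log` (`d_M ≤ 2Ψ(log M)`, the diagonal
  entry); `y = −e_{M−1}` gives **`screwPivot_le_two_zetaScrew_log_div`**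
  (`d_M ≤ 2Ψ(log(M/(M−1)))` = the variance of the newest INCREMENT of the screw line — the
  «innovation ≤ increment» inequality, i.e. `G(M) ≥ 0`), for every `M ≥ 2` at which `S_{M−1} ≻ 0`;
  hence along every certified pivot ladder (`screwPivot_le_two_zetaScrew_log_div_of_ladder`, RH-free)
  and for every `M` under RH (`screwPivot_le_two_zetaScrew_log_div_of_riemannHypothesis`, which also
  recalls `0 < d_M`).

What is NOT here: any asymptotics of `2Ψ(h)` as `h → 0` (PIVOT-LAW §2a(ii): `2Ψ(h) = h log(1/h) +
(1 − γ₀ − log 2π)h + O(h²)`, so `L(M) = log M − (log 2π + γ₀ − 1) + o(1)`) — that needs the small-`t`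
expansion of the Hurwitz–Lerch term of `Ψ` and is not attempted. Nothing in this file is progress on
`ζ`: the RH-free statements are linear algebra plus `G(t,t) = 2Ψ(t)` and the evenness of `Ψ`; the
RH-conditional one only re-uses `screwMatrix_posDef_of_riemannHypothesis`.
Reference for the kernel: M. Suzuki, J. Lond. Math. Soc. (2) 108 (2023) = arXiv:2206.03682, (1.1), (1.4)
[Suzuki2023]; the log-integer nodes and the pivots are the route's objects, not Suzuki's.
-/

noncomputable section

-- D-0017: `Summit.<S>.<S>.…` is the designed namespace of a single-problem summit.
set_option linter.dupNamespace false

namespace Summit.RiemannHypothesis.RiemannHypothesis.Theorems.IntegerScrew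

open Literature.NumberTheory.LFunctions Matrix
open scoped BigOperators

/-! ### Linear algebra: completing the square against `A ≻ 0` -/

/-- COMPLETING THE SQUARE: for a real positive definite matrix `A` and vectors `b, y`,
`−(bᵀ A⁻¹ b) ≤ yᵀ A y + 2 bᵀ y` (expand `0 ≤ (y + A⁻¹b)ᵀ A (y + A⁻¹b)`; equality at `y = −A⁻¹ b`).
[folklore] -/
theorem neg_dotProduct_inv_mulVec_le {m : Type*} [Fintype m] [DecidableEq m]
    {A : Matrix m m ℝ} (hA : A.PosDef) (b y : m → ℝ) :
    -(b ⬝ᵥ A⁻¹ *ᵥ b) ≤ y ⬝ᵥ A *ᵥ y + 2 * (b ⬝ᵥ y) := by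
  have hAT : Aᵀ = A := by
    have h := hA.1
    rwa [IsHermitian, conjTranspose_eq_transpose_of_trivial] at h
  have hdet : IsUnit A.det := isUnit_iff_ne_zero.mpr hA.det_pos.ne'
  have hAw : A *ᵥ (A⁻¹ *ᵥ b) = b := by
    rw [mulVec_mulVec, mul_nonsing_inv _ hdet, one_mulVec]
  have hwy : (A⁻¹ *ᵥ b) ⬝ᵥ A *ᵥ y = b ⬝ᵥ y := by
    rw [dotProduct_mulVec, ← mulVec_transpose, hAT, hAw]
  have h0 : 0 ≤ (y + A⁻¹ *ᵥ b) ⬝ᵥ A *ᵥ (y + A⁻¹ *ᵥ b) := by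
    simpa using hA.posSemidef.dotProduct_mulVec_nonneg (y + A⁻¹ *ᵥ b)
  have hexp : (y + A⁻¹ *ᵥ b) ⬝ᵥ A *ᵥ (y + A⁻¹ *ᵥ b) =
      y ⬝ᵥ A *ᵥ y + 2 * (b ⬝ᵥ y) + b ⬝ᵥ A⁻¹ *ᵥ b := by
    rw [mulVec_add, add_dotProduct, dotProduct_add, dotProduct_add, hAw, hwy, dotProduct_comm y b,
      dotProduct_comm (A⁻¹ *ᵥ b) b]
    ring
  linarith

/-- The value of the quadratic form at the optimum: for `A ≻ 0` and `φ := A⁻¹ b`,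
`φᵀ A φ − 2 bᵀ φ = −bᵀ A⁻¹ b`. [folklore] -/
theorem dotProduct_inv_mulVec_eq_form {m : Type*} [Fintype m] [DecidableEq m]
    {A : Matrix m m ℝ} (hA : A.PosDef) (b : m → ℝ) :
    (A⁻¹ *ᵥ b) ⬝ᵥ A *ᵥ (A⁻¹ *ᵥ b) - 2 * (b ⬝ᵥ A⁻¹ *ᵥ b) = -(b ⬝ᵥ A⁻¹ *ᵥ b) := by
  have hdet : IsUnit A.det := isUnit_iff_ne_zero.mpr hA.det_pos.ne'
  have hAw : A *ᵥ (A⁻¹ *ᵥ b) = b := by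
    rw [mulVec_mulVec, mul_nonsing_inv _ hdet, one_mulVec]
  rw [hAw, dotProduct_comm (A⁻¹ *ᵥ b) b]
  ring

/-! ### The pivot as the scalar Schur complement and as a minimum -/

/-- With `S_{n+1} ≻ 0`, the pivot `d_{n+2}` IS the scalar Schur complement:
`d_{n+2} = 2Ψ(log(n+2)) − bᵀ S_{n+1}⁻¹ b`, `b = screwBorder n` (last column of `S_{n+2}`).
[folklore] -/
theorem screwPivot_add_two_eq_schur (n : ℕ) (hn : (screwMatrix n).PosDef) :
    screwPivot (n + 2) =
      2 * zetaScrew (Real.log ((n + 2 : ℕ) : ℝ)) -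
        (fun i => screwBorder n i 0) ⬝ᵥ (screwMatrix n)⁻¹ *ᵥ (fun i => screwBorder n i 0) := by
  letI : Invertible (screwMatrix n) := hn.isUnit.invertible
  have hdn : 0 < screwDet n := hn.det_pos
  rw [screwPivot_add_two, screwDet_succ n, mul_div_cancel_left₀ _ hdn.ne', Matrix.det_fin_one,
    Matrix.sub_apply, Matrix.mul_assoc, Matrix.mul_apply]
  simp [screwCorner, zetaScrewKernel_self, Matrix.mul_apply, mulVec, dotProduct]

/-- The pivot is the quadratic form of `S_{n+2}` at `(−φ, 1)` with `φ := S_{n+1}⁻¹ b` — the optimal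
one-step linear predictor of the newest node from the earlier ones:
`d_{n+2} = 2Ψ(log(n+2)) + φᵀ S_{n+1} φ − 2 bᵀ φ`. [folklore] -/
theorem screwPivot_add_two_eq_form_filter (n : ℕ) (hn : (screwMatrix n).PosDef) :
    screwPivot (n + 2) =
      2 * zetaScrew (Real.log ((n + 2 : ℕ) : ℝ))
        + ((screwMatrix n)⁻¹ *ᵥ fun i => screwBorder n i 0) ⬝ᵥ
            screwMatrix n *ᵥ ((screwMatrix n)⁻¹ *ᵥ fun i => screwBorder n i 0)
        - 2 * ((fun i => screwBorder n i 0) ⬝ᵥ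
            (screwMatrix n)⁻¹ *ᵥ fun i => screwBorder n i 0) := by
  rw [screwPivot_add_two_eq_schur n hn, add_sub_assoc, dotProduct_inv_mulVec_eq_form hn]
  ring

/-- **VARIATIONAL UPPER BOUND** (the pivot is a minimum): with `S_{n+1} ≻ 0`, for EVERY `y : Fin n → ℝ`,
`d_{n+2} ≤ 2Ψ(log(n+2)) + yᵀ S_{n+1} y + 2 bᵀ y` — the right-hand side is the quadratic form of
`S_{n+2}` at the vector `(y, 1)`; with `screwPivot_add_two_eq_form_filter` this says
`d_{n+2} = min_y Q_{S_{n+2}}(y, 1)`. [folklore] -/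
theorem screwPivot_add_two_le_form (n : ℕ) (hn : (screwMatrix n).PosDef) (y : Fin n → ℝ) :
    screwPivot (n + 2) ≤
      2 * zetaScrew (Real.log ((n + 2 : ℕ) : ℝ)) + y ⬝ᵥ screwMatrix n *ᵥ y
        + 2 * ((fun i => screwBorder n i 0) ⬝ᵥ y) := by
  rw [screwPivot_add_two_eq_schur n hn]
  have h := neg_dotProduct_inv_mulVec_le hn (fun i => screwBorder n i 0) y
  linarith

/-! ### Trial vectors: `y = 0` and `y = −e_{last}` -/

/-- Trial vector `y = 0` (predict the newest node by `0`): `d_{n+2} ≤ 2Ψ(log(n+2))`, the diagonal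
entry of `S_{n+2}`, whenever `S_{n+1} ≻ 0`. [folklore] -/
theorem screwPivot_add_two_le_diag (n : ℕ) (hn : (screwMatrix n).PosDef) :
    screwPivot (n + 2) ≤ 2 * zetaScrew (Real.log ((n + 2 : ℕ) : ℝ)) := by
  simpa using screwPivot_add_two_le_form n hn 0

/-- Trial vector `y = −e_{last}` (predict the newest node by the previous one): with `S_{n+2} ≻ 0`,
`d_{n+3} ≤ 2Ψ(log((n+3)/(n+2)))` — the squared length of the newest INCREMENT of the screw line
(`‖x_{log M} − x_{log(M−1)}‖² = G(a,a) + G(b,b) − 2G(a,b) = 2Ψ(a − b)`). [folklore] -/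
theorem screwPivot_add_three_le_increment (n : ℕ) (hn : (screwMatrix (n + 1)).PosDef) :
    screwPivot (n + 3) ≤ 2 * zetaScrew (Real.log (((n + 3 : ℕ) : ℝ) / ((n + 2 : ℕ) : ℝ))) := by
  have h := screwPivot_add_two_le_form (n + 1) hn (Pi.single (Fin.last n) (-1))
  have hlast : ((Fin.last n : ℕ) + 2 : ℕ) = n + 2 := by simp
  have h1 : Pi.single (Fin.last n) (-1 : ℝ) ⬝ᵥ screwMatrix (n + 1) *ᵥ Pi.single (Fin.last n) (-1) =
      2 * zetaScrew (Real.log ((n + 2 : ℕ) : ℝ)) := by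
    rw [single_dotProduct]
    simp only [mulVec, dotProduct_single, screwMatrix_diag, hlast]
    ring
  have h2 : (fun i => screwBorder (n + 1) i 0) ⬝ᵥ Pi.single (Fin.last n) (-1 : ℝ) =
      -(zetaScrew (Real.log ((n + 2 : ℕ) : ℝ)) + zetaScrew (Real.log ((n + 3 : ℕ) : ℝ))
        - zetaScrew (Real.log ((n + 2 : ℕ) : ℝ) - Real.log ((n + 3 : ℕ) : ℝ))) := by
    rw [dotProduct_single]
    simp only [screwBorder, Matrix.of_apply, hlast, zetaScrewKernel_def]
    ring
  have h3 : zetaScrew (Real.log ((n + 2 : ℕ) : ℝ) - Real.log ((n + 3 : ℕ) : ℝ)) =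
      zetaScrew (Real.log (((n + 3 : ℕ) : ℝ) / ((n + 2 : ℕ) : ℝ))) := by
    rw [← zetaScrew_neg, neg_sub, ← Real.log_div (by positivity) (by positivity)]
  have h23 : ((n + 1 + 2 : ℕ) : ℝ) = ((n + 3 : ℕ) : ℝ) := by push_cast; ring
  rw [h23] at h
  linarith [h, h1, h2, h3]

/-! ### The innovation bound in the `M`-indexed form of the pivot ladders -/

/-- **`d_M ≤ 2Ψ(log M)`** for every `M ≥ 2` at which `S_{M−1} = screwMatrix (M − 2)` is positive
definite (equality at `M = 2`). [folklore] -/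
theorem screwPivot_le_two_zetaScrew_log (M : ℕ) (hM : 2 ≤ M) (h : (screwMatrix (M - 2)).PosDef) :
    screwPivot M ≤ 2 * zetaScrew (Real.log (M : ℝ)) := by
  obtain ⟨n, rfl⟩ : ∃ n, M = n + 2 := ⟨M - 2, by omega⟩
  have := screwPivot_add_two_le_diag n h
  simpa using this

/-- **INNOVATION ≤ INCREMENT: `d_M ≤ 2Ψ(log(M/(M−1)))`** for every `M ≥ 2` at which
`S_{M−1} = screwMatrix (M − 2)` is positive definite (equality at `M = 2`, where both sides are
`2Ψ(log 2)`). In the track's notation `M·d_M ≤ L(M) := M·2Ψ(h_M)`, `h_M = log(M/(M−1))`, i.e. the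
«innovation deficit» `G(M) = L(M) − M·d_M` is `≥ 0`. [folklore] -/
theorem screwPivot_le_two_zetaScrew_log_div (M : ℕ) (hM : 2 ≤ M)
    (h : (screwMatrix (M - 2)).PosDef) :
    screwPivot M ≤ 2 * zetaScrew (Real.log ((M : ℝ) / ((M : ℝ) - 1))) := by
  obtain ⟨n, rfl⟩ : ∃ n, M = n + 2 := ⟨M - 2, by omega⟩
  cases n with
  | zero =>
    rw [screwPivot_two]
    norm_num
  | succ k =>
    have := screwPivot_add_three_le_increment k h
    have e1 : ((k + 3 : ℕ) : ℝ) = ((k + 1 + 2 : ℕ) : ℝ) := by push_cast; ring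
    have e2 : ((k + 2 : ℕ) : ℝ) = ((k + 1 + 2 : ℕ) : ℝ) - 1 := by push_cast; ring
    rw [e1, e2] at this
    exact this

/-- The innovation bound ALONG A CERTIFIED LADDER (RH-free): if the pivots `d_2, …, d_{N+1}` are all
positive (one LDLᵀ pass), then `d_M ≤ 2Ψ(log(M/(M−1)))` for every `2 ≤ M ≤ N + 2` — including the
next, not yet certified, rung `M = N + 2`. [folklore] -/
theorem screwPivot_le_two_zetaScrew_log_div_of_ladder (N : ℕ)
    (hlad : ∀ M : ℕ, 2 ≤ M → M ≤ N + 1 → 0 < screwPivot M) (M : ℕ) (hM : 2 ≤ M)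
    (hMN : M ≤ N + 2) :
    screwPivot M ≤ 2 * zetaScrew (Real.log ((M : ℝ) / ((M : ℝ) - 1))) :=
  screwPivot_le_two_zetaScrew_log_div M hM
    (screwMatrix_posDef_of_screwPivot_pos_le N hlad (M - 2) (by omega))

/-- Under RH every screw matrix is positive definite, so for EVERY `M ≥ 2`:
`0 < d_M ≤ 2Ψ(log(M/(M−1)))` — the two-sided DERIVED layer of the pivot law
(`0 ≤ G(M) < L(M)` in the track's notation). [folklore] -/
theorem screwPivot_le_two_zetaScrew_log_div_of_riemannHypothesis (hRH : _root_.RiemannHypothesis)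
    (M : ℕ) (hM : 2 ≤ M) :
    0 < screwPivot M ∧ screwPivot M ≤ 2 * zetaScrew (Real.log ((M : ℝ) / ((M : ℝ) - 1))) :=
  ⟨screwPivot_pos_of_posDef (screwMatrix_posDef_of_riemannHypothesis hRH) M hM,
    screwPivot_le_two_zetaScrew_log_div M hM (screwMatrix_posDef_of_riemannHypothesis hRH (M - 2))⟩

/-- Under RH, also `d_M ≤ 2Ψ(log M)` for every `M ≥ 2`. [folklore] -/
theorem screwPivot_le_two_zetaScrew_log_of_riemannHypothesis (hRH : _root_.RiemannHypothesis)
    (M : ℕ) (hM : 2 ≤ M) :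
    screwPivot M ≤ 2 * zetaScrew (Real.log (M : ℝ)) :=
  screwPivot_le_two_zetaScrew_log M hM (screwMatrix_posDef_of_riemannHypothesis hRH (M - 2))

end Summit.RiemannHypothesis.RiemannHypothesis.Theorems.IntegerScrew
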